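import Summits.QuantumFields.YangMills.Theorems.UnitScaleTiltProp7SigmaRepOfThm2S
import Summits.QuantumFields.YangMills.Theorems.UnitScaleTiltProp7SPrintDefs
import HarnessLib

/-!
# AUX-1 of the GUARDED CHAIN (★★OWNER RULING №55∕№56, chair №77 (B)): `hcoW_of_hcoSigmaG` = GUARD EDITION (L ≥ 5) of ✓`Prop7HcoWOfHcoSigma.hcoW_of_hcoSigma` — the [B8] Thm 2 socket
# `hThm2S` and the conclusion `hcoW` both take the token-run `5 ≤ L →` after `∀ (L : ℕ), 1 < L →`; proof = the parent's with `intro L hL h5 B₁ hB₁` and `hThm2S L hL h5` (2 tokens).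
# Consumer: S23LLiftᵍ (`hcoW_of_hcoSigma hThm2S hcoS` ↦ the guarded letter `hcoW` of S18LLiftᵍ…S5ECtrDLiftᵍ).  THEOREMS ONLY; `--supports stmt-QuantumFields-19200 --as helper`;
# «EX GUARDED (L ≥ 5)» line — NOT the registered EX; rung R3 = SU(2) YM₃ on T³ — NOT d = 4, NOT infinite volume, NOT a mass gap, NOT Clay.

References: T. Bałaban, CMP 102 (1985) 277–309 [Balaban1985Variational] (Prop. 2, (18)–(21) pp.280–281, (141)–(143) p.299, Prop. 7 p.299); CMP 99 (1985) 75–102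
[Balaban1985RegularSpaces] (Thm 2 p.83, (1.29) p.81, (1.36)–(1.38) p.82); CMP 98 (1985) 17–51 [Balaban1985Averaging] ((84)–(88), (92) p.31, Prop. 2 p.26).
-/

set_option autoImplicit false
noncomputable section

open scoped BigOperators Matrix.Norms.L2Operator Matrix Topology
open Filter NormedSpace

namespace Summit.QuantumFields.YangMills.Theorems.Prop7HcoWOfHcoSigmaG

open Literature.MathematicalPhysics.QuantumFieldTheory.Balaban1983to89
open Literature.MathematicalPhysics.QuantumFieldTheory.Balaban1983to89.T3ContinuumYM3Torus
open Literature.MathematicalPhysics.QuantumFieldTheory.Balaban1983to89.T3UnitLawDensityEML (ℰp)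
open Literature.MathematicalPhysics.QuantumFieldTheory.Balaban1983to89.T3ConstrainedMinimiser (fibre)
open Literature.MathematicalPhysics.QuantumFieldTheory.Balaban1983to89.T3PrintedRegularMinimiser
open Literature.MathematicalPhysics.QuantumFieldTheory.Balaban1983to89.T3RegularMinimiser
open Literature.MathematicalPhysics.QuantumFieldTheory.Balaban1983to89.T3Thm1Carrier
open T4Continuum BlockAveraging AveragingRT ExpMeanLog
open B10Eq27TorusAxialLog (pull)
open T3SectALandauChart (emb15 eta bgUnits In19)
open B7Prop1Explicit renaming Site → LSite
open B7Prop2Explicit (C0 c2' C0_pos c2'_pos)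
open B8Thm2SetupTorus (Thm2SetupSUAt)
open Summit.QuantumFields.YangMills.Theorems.Prop7TPrint (expHermField)
open Summit.QuantumFields.YangMills.Theorems.Prop7SPrint (basePt RestrictedPrint AvgCondPrint IsLandauPrint)
open Summit.QuantumFields.YangMills.Theorems.Prop7SigmaRepOfThm2S (exists_sigmaRep_of_thm2S)

set_option maxHeartbeats 400000 in
/-- («AUX-1».) GUARD EDITION (L ≥ 5) of ✓`Prop7HcoWOfHcoSigma.hcoW_of_hcoSigma`: `hThm2S` and the conclusion `hcoW` guarded by `5 ≤ L →` after `1 < L →`;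
proof = the parent's with `h5` threaded at the one use of Thm 2 (✓`exists_sigmaRep_of_thm2S` at the member's `L`).  CONDITIONAL on `hcoΣ`; not the registered EX.
[cite: Balaban1985Variational, Prop. 2 p.281, (18)-(21) pp.280-281, (141)-(142) p.299; Balaban1985RegularSpaces, Thm 2 p.83; Balaban1985Averaging, (84)-(88) p.31] -/
theorem hcoW_of_hcoSigmaG
    (hThm2S : ∀ (L : ℕ), 1 < L → 5 ≤ L → ∃ B₁ c₁ : ℝ, 0 < B₁ ∧ 0 < c₁ ∧ ∀ (F : T3Family), F.L = L → ∀ (n K : ℕ), n < K →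
      ∃ (β₀ B₂ : ℝ) (len : LSite (F.P K).d → ℝ),
        Thm2SetupSUAt (F.P K) 2 (K - n) (eta F n K) β₀ B₁ B₂ c₁ len (fun _ => True))
    (hcoS : ∀ (L : ℕ), 1 < L → ∀ (B₁' : ℝ), 0 < B₁' → ∃ e₇ : ℝ, 0 < e₇ ∧
      ∀ (F : T3Family), F.L = L → ∀ (n K : ℕ) (hnK : n < K) (e : ℝ) (V : GaugeField (F.P n) 0 (Matrix.specialUnitaryGroup (Fin 2) ℂ))
        (W : GaugeField (F.P K) 0 (Matrix.specialUnitaryGroup (Fin 2) ℂ)) (X : PBond (F.P K) 0 → Matrix (Fin 2) (Fin 2) ℂ),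
        0 < e → e ≤ e₇ → W ∈ regFibrePr F n K hnK.le e V →
        (∀ γ : ℝ → GaugeField (F.P K) 0 (Matrix.specialUnitaryGroup (Fin 2) ℂ), γ 0 = W → (∀ t, γ t ∈ fibre F ℰp n K hnK.le V) →
          (∀ b, DifferentiableAt ℝ (fun t => ((γ t b : Matrix.specialUnitaryGroup (Fin 2) ℂ) : Matrix (Fin 2) (Fin 2) ℂ)) 0) →
            deriv (fun t => wilsonAction4 (γ t)) 0 = 0) →
        In19 F n K (2 * B₁' * e) W (expHermField X) X → AvgCondPrint F n K hnK.le V W X → IsLandauPrint F n K W X →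
          wilsonAction4 W ≤ wilsonAction4 (emb15 W (expHermField X))) :
    ∀ (L : ℕ), 1 < L → 5 ≤ L → ∀ (B₁ : ℝ), 0 < B₁ → ∃ e₇ c₇ : ℝ, 0 < e₇ ∧ 0 < c₇ ∧
      ∀ (F : T3Family), F.L = L → ∀ (n K : ℕ) (hnK : n < K) (e α : ℝ) (V : GaugeField (F.P n) 0 (Matrix.specialUnitaryGroup (Fin 2) ℂ))
        (W U₁ : GaugeField (F.P K) 0 (Matrix.specialUnitaryGroup (Fin 2) ℂ)) (u : GaugeTransf (F.P K) 0 (Matrix.specialUnitaryGroup (Fin 2) ℂ))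
        (A : PBond (F.P K) 0 → Matrix (Fin 2) (Fin 2) ℂ),
        0 < e → e ≤ e₇ → 0 < α → α ≤ c₇ → W ∈ regFibrePr F n K hnK.le e V →
        (∀ γ : ℝ → GaugeField (F.P K) 0 (Matrix.specialUnitaryGroup (Fin 2) ℂ), γ 0 = W → (∀ t, γ t ∈ fibre F ℰp n K hnK.le V) →
          (∀ b, DifferentiableAt ℝ (fun t => ((γ t b : Matrix.specialUnitaryGroup (Fin 2) ℂ) : Matrix (Fin 2) (Fin 2) ℂ)) 0) →
            deriv (fun t => wilsonAction4 (γ t)) 0 = 0) →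
        RestrictedPrint F n K W u → (∀ b : PBond (F.P K) 0, IsSelfAdjoint (A b)) →
        (∀ b : PBond (F.P K) 0, ((U₁ b : Matrix.specialUnitaryGroup (Fin 2) ℂ) : Matrix (Fin 2) (Fin 2) ℂ) = exp (Complex.I • ((eta F n K) • A b))) →
        (∃ (β₀ B₂ : ℝ) (len : B7Prop1Explicit.Site (F.P K).d → ℝ),
          B8Thm2TorusAt.C136T (F.P K).L (K - n) (eta F n K) β₀ B₁ B₂ len α (pull (bgUnits F K W) (basePt F n K)) (pull A (basePt F n K))) →
        B8Eq138LandauZd.IsLandau138 (F.P K).L (K - n) (eta F n K) (Set.univ : Set (B7Prop1Explicit.Site (F.P K).d)) (B8Thm4TorusAt.torusLam (K - n))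
          (pull (bgUnits F K W) (basePt F n K)) (pull A (basePt F n K)) →
        B8Thm2TorusAt.C139T (F.P K).L (K - n) (eta F n K) B₁ α (pull (bgUnits F K W) (basePt F n K)) (pull A (basePt F n K)) →
        GaugeField.gaugeAct u (emb15 W U₁) ∈ regFibrePr F n K hnK.le e V →
          wilsonAction4 W ≤ wilsonAction4 (emb15 W U₁) := by
  intro L hL h5 B₁ hB₁
  obtain ⟨B₁T, c₁T, hB₁T, hc₁T, hT⟩ := hThm2S L hL h5
  obtain ⟨B₁', c₁', hB₁', hc₁', HS⟩ := exists_sigmaRep_of_thm2S (L := L) hB₁T hc₁T hT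
  obtain ⟨e₇, he₇, Hco⟩ := hcoS L hL B₁' hB₁'
  have hC0 : 0 < C0 3 := C0_pos 3
  have hc2 : 0 < c2' 3 L := c2'_pos 3 L (by omega)
  -- windows of the Σ-representation: `2e ≤ c₁′`, `C₀·2e ≤ ⅓`, `4e ≤ c₂′`
  refine ⟨min e₇ (min (c₁' / 2) (min ((6 * C0 3)⁻¹) (c2' 3 L / 4))), 1, ?_, one_pos, ?_⟩
  · exact lt_min he₇ (lt_min (by positivity) (lt_min (by positivity) (by positivity)))
  intro F hF n K hnK e α V W U₁ u A he heε _hα _hαc hWreg hEL _hRP _hA _hU₁ _h136 _h138 _h139 hmem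
  have he₇' : e ≤ e₇ := heε.trans (min_le_left _ _)
  have h2e : 2 * e ≤ c₁' := by
    have := heε.trans ((min_le_right _ _).trans (min_le_left _ _)); linarith
  have hα3 : C0 3 * (2 * e) ≤ 1 / 3 := by
    have h1 : e ≤ (6 * C0 3)⁻¹ := heε.trans ((min_le_right _ _).trans ((min_le_right _ _).trans (min_le_left _ _)))
    calc C0 3 * (2 * e) ≤ C0 3 * (2 * (6 * C0 3)⁻¹) := by gcongr
      _ = 1 / 3 := by field_simp; ring
  have hα2 : 2 * (2 * e) ≤ c2' 3 L := by
    have := heε.trans ((min_le_right _ _).trans ((min_le_right _ _).trans (min_le_right _ _))); linarith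
  -- the Σ-representative of the competitor `(e^{iηA}W)^u`
  obtain ⟨u'', X'', hW', h19, h20, h21, hact⟩ :=
    HS F hF n K hnK e V W he h2e hα3 hα2 hWreg (GaugeField.gaugeAct u (emb15 W U₁)) hmem
  have hle : wilsonAction4 W ≤ wilsonAction4 (emb15 W (expHermField X'')) := Hco F hF n K hnK e V W X'' he he₇' hWreg hEL h19 h20 h21
  have hga : wilsonAction4 (GaugeField.gaugeAct u (emb15 W U₁)) = wilsonAction4 (emb15 W U₁) :=
    T4WilsonGaugeFlatDirection.wilsonAction_gaugeAct 1 u _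
  rw [← hga, hact]
  exact hle

end Summit.QuantumFields.YangMills.Theorems.Prop7HcoWOfHcoSigmaG

end
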